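import Summits.AtomisticToContinuum.Crystallization.Theorems.ChartedZeroExcessLayeredLatticeLiouvilleUE

/-!
# Zero-excess layered lattice Liouville — part UF (lens-2 g46, node «CalmMoat» beneath [T_cl] `CloudTameWindowPG` and [T] `TameWindowPG`):
# the special/generic cut of the hot-star exclusion by ENCLOSURE — `[T] ⟺ [E_w] EnclosedTameWindowPG ∧ [T_esc] EscapingTameWindowPG` (PROVED),
# the special side fed by the LOCAL, registration-free statement [I_K] `CalmMoatPG` («a calm moat around a finite cluster forces the cluster
# tame»), which CONTAINS g45's [I] (`[I_K] ⇒ [I]`, PROVED); the residual [T_esc] is WEAKER than g45's residual [T_cl] (`[T_cl] ⇒ [T_esc]`, PROVED)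

Line `_16XH19(_tol)` of statement 26636, (M)-side, after parts UC/UD/UE: (M) ⟸ Gehring-leaf ∧ [I] ∧ [T_cl] ∧ [KS] ∧ [W] ∧ [CC°_W], every seam proved.
[T_cl] (part UE) — «near-flat fat GSC door windows have no CLOUDED `ϑ`-hot star» (collar `collar S x ℓ` not `(ϑc, ωc)`-coherent) — is the
residual this file cuts; after it the (M)-side reads (M) ⟸ Gehring-leaf ∧ [I_K] ∧ [T_esc] ∧ [KS] ∧ [W] ∧ [CC°_W] (`strainNonConcentrationPG_of_
calmMoat_line`, PROVED), with [I_K] LOCAL and [T_esc] strictly inside [T_cl].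

(α) THE DICHOTOMY ONE LEVEL UP: CONTAINERS INSTEAD OF COLLARS.  Part UE reads the isolation of a hot star `x` off ONE set, its collar — and
`collar S x ℓ = moat S {x} ℓ` (`moat_singleton`).  A clouded hot star may still be ENCLOSED: together with the finitely many non-calm sites around
it, it may sit in a finite CONTAINER `K ⊆ S`, `x ∈ K`, `#K ≤ M`, whose MOAT `moat S K ℓ` — the sites within `ℓ` of `K` and farther than `8` from
every site of `K` (`four_lt_dist_of_mem_moat`: moat stars do not meet the closed `4`-stars of `K`) — is `(ϑc, ωc)`-coherent to the chart lattice
(`IsEnclosed`).  The local exchange argument behind [I] does not care about the shape of the container: it needs a calm closed moat and a hot site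
inside.  What it cannot reach is a hot star whose non-calm company ESCAPES every container of `≤ M` sites: by the greedy construction `K₀ = {x}`,
`K_{i+1} = K_i ∪ {a non-coherent moat site of K_i}` (`exists_warm_moat_of_not_isEnclosed`, PROVED, is the step) such a star heads a `16`-linked,
pairwise `8`-separated CHAIN of `≥ M` non-calm stars — an EXTENDED hot structure (filament, platelet edge, anomaly string): the «thin cloud» of
NODE-g45 §(β), now isolated as the generic class, with every COMPACT cloud — fat or thin, of `< M` cores — moved to the special side.
STRUCTURE-VS-RANDOMNESS reading: for `η ≤ η₁` the non-calm set of a near-flat window is a sparse dust (Chebyshev on the budget of `IsGlobalReg`: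
`#{non-calm in win D} ≤ Cg·(D/R)·η·nK(win D)/ϑc²`, density `→ 0`); a dust either percolates along a chain through `x` (generic) or leaves `x` enclosed
(special).  Density bounds give sparsity, never emptiness: emptiness of the hot set needs a LOCAL statement, and [I_K] is the widest one exchange supports.

(β) THE CUT (exhaustion by `em` on enclosure, PROVED; [T] recovered EXACTLY: `tameWindowPG_iff_enclosedTameWindow_and_escaping`, the one `iff`).
* SPECIAL = ENCLOSED hot stars: excluded by [E_w] `EnclosedTameWindowPG` ([T]'s binders, conclusion at the `M`-enclosed sites of `win 9R`; WEAKER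
  than [T], PROVED; CONTAINS g45's [I_w], `calmCollarWindowPG_of_enclosedTameWindowPG`, PROVED), fed by the LOCAL statement [I_K] `CalmMoatPG` —
  NO window, NO registration, NO `η`, NO `R`: «in a θ-good e⋆-GSC door set, a finite cluster `K` of `≤ M` sites whose moat is `(ϑc, ωc)`-coherent
  to an equilibrium chart lattice is `ϑ`-tame» (`enclosedTameWindowPG_of_calmMoatPG`, PROVED; `K = {x}` gives [I]: `calmCollarPG_of_calmMoatPG`).
  Mechanism (named, not typed): ONE grand-canonical exchange — the sites within `(8+ℓ)/2` of `K` replaced by the chart patch fitted to the calm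
  moat — priced by e⋆-GSC: cost = feathering of the moat's OWN deviation field, at worst `C·(ϑc² + ωc²)·#moat ≤ C·(ϑc² + ωc²)·#K·n(ℓ)`, plus
  `r⁻⁶` tails; gain `≥ c_hot ≈ c·(ϑ/4)²·n(4)` from the ONE hot star guaranteed inside.  With `(ϑ/ϑc)² = 10⁴ ≫ n(16)/n(4) ≈ 80` the exchange has
  force for containers of `M ≲ 10²·c/C` cores — hence the record `M = clusterSize = 12`; for larger `M` [I_K] is the finite-volume form of the
  line's Liouville statement (e⋆-GSC SELECTS the Cauchy–Born filling of a calm moat; local uniqueness of that filling: E–Ming, Ortner–Theil,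
  Braun–Schmidt; global selection among clean fillings open).  MECHANISM-NAMED · LOCAL · FINITE · UNDECIDED(stated tests) · ATTACKABLE·L.
* GENERIC = ESCAPING hot stars (`¬ IsEnclosed`): [T_esc] `EscapingTameWindowPG` is [T] restricted to them — WEAKER than [T] (PROVED) and than
  g45's residual [T_cl] (`escapingTameWindowPG_of_cloudTameWindowPG`, `1 ≤ M`, PROVED; STRICTLY at currency level: a hot star with ONE warm
  companion at distance `12` in an otherwise calm environment violates [T_cl] and is `2`-enclosed by `K = {x, companion}`, hence not addressed
  by [T_esc]).  NEW · GSC-priced · UNDECIDED(stated test (F0e) «MoatScan») · INSTRUMENTABLE · IDEA-NEEDED (chains: an exchange organised ALONG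
  the chain — a tube competitor — has gain and cost both lineal and no margin at the calm threshold; the two typed dials, `M ↑` and `ϑc ↑`
  below `ϑ`, move chains of bounded length, resp. of distinctly warm cores, to the special side: `EscapingTameWindowPG.anti`).
TRADE-OFF typed: [I_K] STRENGTHENS and [T_esc] WEAKENS as `M` grows, as `ϑc, ωc` grow, or as `ℓ` shrinks (`CalmMoatPG.mono`,
`EscapingTameWindowPG.anti`) — content moves between the sides, never out of the pair.  DEGENERATE ENDS (guards, PROVED): `M = 0` — nothing is
enclosed, [I_K] is trivial (`calmMoatPG_zero`) and [T_esc] is [T] itself (`tameWindowPG_of_escapingTameWindowPG_zero`); `ℓ ≤ 8`, `1 ≤ M` — every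
site is enclosed by `{x}` (empty moat), [T_esc] is vacuous (`escapingTameWindowPG_of_le_eight`) and [I_K] a global tame-Liouville claim.  Record
literals `(aHi; Λ, θ, s; ϑ; ϑc, ωc, ℓ; M) = (1; 2, 1/16, 1/50; tameRadius; calmLevel, calmLevel, collarRadius; clusterSize)`.

(γ) WHY THIS IS NOVEL (by construction different from the lineage and the other lenses).  g43 cut by AMPLITUDE on whole windows (tame/hot), g44 by
amplitude one level down (coherent basin), g45 by the geometry of ONE collar (isolated/clouded); g46 cuts by the CONNECTIVITY of the non-calm set
— the container is a free boundary, enclosure a percolation-type property — so that the residual speaks of EXTENDED hot structures only and the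
whole compact case (every anomaly complex of `< M` cores, whatever its shape) lands in ONE local finite statement; the other lenses' nodes
concern statements 11071, 14231, 31280, 27623 — none reads 26636.  No literature claim is made by the three Props (sources = mechanism pointers).
-/

noncomputable section

open scoped BigOperators
open MeasureTheory Set Metric Filter Topology
open Summit.AtomisticToContinuum.Crystallization.Theorems.ChartedPlanarOrderRigidityDoor (E3 atomsIn)
open Summit.AtomisticToContinuum.Crystallization.Theorems.ChartedPlanarOrderDensityDichotomy (μS IsSep nK nK_nonneg)
open Summit.AtomisticToContinuum.Crystallization.Theorems.ChartedPlanarOrderCleanScaleP (IsCleanP IsDoorSetP)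
open Summit.AtomisticToContinuum.Crystallization.Theorems.ChartedPlanarOrderMesoCut (LayeredHom EnvClose)
open Summit.AtomisticToContinuum.Crystallization.Theorems.ChartedPlanarOrderDoorLayered (atomsIn_subset)
open Summit.AtomisticToContinuum.Crystallization.Theorems.ChartedPlanarOrderDoorLayeredOsc (IsTwoShellAffineGood)
open Literature.Analysis.PDE (finavg ZatorskaGoldstein2005_localGehringLemmaCounting)

namespace Summit.AtomisticToContinuum.Crystallization.Theorems.ChartedZeroExcessLayeredLatticeLiouville

/-! ### YF.1  The moat of a finite cluster, and enclosure (the currency of the cut) -/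

/-- ★ **`moat S K ℓ`** — the sites of `S` within `ℓ` of SOME site of the cluster `K` and farther than `8` from EVERY site of `K`: those near `K`
whose `4`-stars meet no closed `4`-star of `K` (`four_lt_dist_of_mem_moat`).  For a single site it is the collar of part UE (`moat_singleton`).
The ENCLOSURE of a hot star is read off the moats of the finite containers holding it. [this file, g46] -/
def moat (S K : Set E3) (ℓ : ℝ) : Set E3 := {p | p ∈ S ∧ (∃ y ∈ K, dist p y < ℓ) ∧ ∀ y ∈ K, 8 < dist p y}

/-- membership in the moat. [this file, g46] -/
theorem mem_moat {S K : Set E3} {ℓ : ℝ} {p : E3} : p ∈ moat S K ℓ ↔ p ∈ S ∧ (∃ y ∈ K, dist p y < ℓ) ∧ ∀ y ∈ K, 8 < dist p y := Iff.rfl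
/-- the moat consists of sites. [this file, g46] -/
theorem moat_subset (S K : Set E3) (ℓ : ℝ) : moat S K ℓ ⊆ S := fun _ hp => hp.1

/-- ★ DICTIONARY with part UE: the moat of a single site is its collar — g45's cut is the case `K = {x}` of this one. [this file, g46] -/
theorem moat_singleton (S : Set E3) (x : E3) (ℓ : ℝ) : moat S {x} ℓ = collar S x ℓ := by
  ext p
  simp only [mem_moat, mem_collar, mem_singleton_iff, exists_eq_left, forall_eq]

/-- the moat grows with the outer radius. [this file, g46] -/
theorem moat_mono (S K : Set E3) {ℓ ℓ' : ℝ} (h : ℓ ≤ ℓ') : moat S K ℓ ⊆ moat S K ℓ' :=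
  fun _ hp => ⟨hp.1, hp.2.1.imp fun _ hy => ⟨hy.1, lt_of_lt_of_le hy.2 h⟩, hp.2.2⟩

/-- DEGENERATE END: for `ℓ ≤ 8` every moat is empty (then every site is enclosed by `{x}` and [T_esc] is vacuous — not the intended regime).
[this file, g46] -/
theorem moat_eq_empty_of_le {S K : Set E3} {ℓ : ℝ} (h : ℓ ≤ 8) : moat S K ℓ = ∅ := by
  ext p
  simp only [mem_empty_iff_false, iff_false]
  intro hp
  obtain ⟨_, ⟨y, hy, hyl⟩, hfar⟩ := mem_moat.1 hp
  have h8 := hfar y hy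
  linarith

/-- WHY THE INNER RADIUS IS `8`: a point within `4` of a moat site is more than `4` from every site of the cluster — moat stars do not meet the
closed `4`-stars of `K`, so hot cores inside the container cannot by themselves spoil the coherence of a moat star. [this file, g46] -/
theorem four_lt_dist_of_mem_moat {S K : Set E3} {ℓ : ℝ} {p q y : E3} (hp : p ∈ moat S K ℓ) (hq : dist q p ≤ 4) (hy : y ∈ K) :
    4 < dist q y := by
  have h8 := (mem_moat.1 hp).2.2 y hy
  have ht := dist_triangle p q y
  rw [dist_comm p q] at ht
  linarith

/-- ★ **`IsEnclosed ϑc ωc ℓ M S H x`** — the site `x` is `M`-ENCLOSED relative to the model set `H`: some finite CONTAINER `K ⊆ S` with `x ∈ K`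
and `#K ≤ M` has a moat `moat S K ℓ` that is `(ϑc, ωc)`-COHERENT to `H` (part UD: every moat star `ϑc`-close to an `H`-star rotated `≤ ωc` from
the orientation of `H`).  Intrinsic given `H`, registration-free, monotone in `ϑc, ωc, M` and antitone in `ℓ` (`IsEnclosed.mono`); a calm collar
encloses with `K = {x}` (`isEnclosed_of_coherent_collar`); nothing is `0`-enclosed (`not_isEnclosed_zero`).  Its negation — `x` ESCAPES every
container of `≤ M` sites — is the generic class of the cut (census instrument (F0e) «MoatScan»). [this file, g46] -/
def IsEnclosed (ϑc ωc ℓ : ℝ) (M : ℕ) (S H : Set E3) (x : E3) : Prop :=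
  ∃ K : Set E3, K ⊆ S ∧ K.Finite ∧ x ∈ K ∧ K.ncard ≤ M ∧ IsCoherentOn ϑc ωc S H (moat S K ℓ)

/-- a site with a calm collar is `M`-enclosed for every `M ≥ 1` (container `{x}`). [this file, g46] -/
theorem isEnclosed_of_coherent_collar {ϑc ωc ℓ : ℝ} {M : ℕ} (hM : 1 ≤ M) {S H : Set E3} {x : E3} (hx : x ∈ S)
    (hc : IsCoherentOn ϑc ωc S H (collar S x ℓ)) : IsEnclosed ϑc ωc ℓ M S H x :=
  ⟨{x}, singleton_subset_iff.2 hx, finite_singleton x, mem_singleton x, by rwa [ncard_singleton], by rwa [moat_singleton]⟩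

/-- an escaping site is clouded in the sense of part UE (its collar is not calm). [this file, g46] -/
theorem not_coherent_collar_of_not_isEnclosed {ϑc ωc ℓ : ℝ} {M : ℕ} (hM : 1 ≤ M) {S H : Set E3} {x : E3} (hx : x ∈ S)
    (h : ¬ IsEnclosed ϑc ωc ℓ M S H x) : ¬ IsCoherentOn ϑc ωc S H (collar S x ℓ) :=
  fun hc => h (isEnclosed_of_coherent_collar hM hx hc)

/-- enclosure is monotone in the calm levels and the container size, antitone in the moat radius. [this file, g46] -/
theorem IsEnclosed.mono {ϑc ϑc' ωc ωc' ℓ ℓ' : ℝ} {M M' : ℕ} (hϑc : ϑc ≤ ϑc') (hωc : ωc ≤ ωc') (hℓ : ℓ' ≤ ℓ) (hM : M ≤ M')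
    {S H : Set E3} {x : E3} (h : IsEnclosed ϑc ωc ℓ M S H x) : IsEnclosed ϑc' ωc' ℓ' M' S H x := by
  obtain ⟨K, hKS, hKf, hxK, hKM, hc⟩ := h
  exact ⟨K, hKS, hKf, hxK, hKM.trans hM, hc.mono hϑc hωc (moat_mono S K hℓ)⟩

/-- DEGENERATE END `M = 0`: no site is `0`-enclosed (a container holds its site). [this file, g46] -/
theorem not_isEnclosed_zero {ϑc ωc ℓ : ℝ} {S H : Set E3} {x : E3} : ¬ IsEnclosed ϑc ωc ℓ 0 S H x := by
  rintro ⟨K, _, hKf, hxK, hK0, _⟩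
  have h := (Set.ncard_pos hKf).2 ⟨x, hxK⟩
  omega

/-- DEGENERATE END `ℓ ≤ 8`: every site is enclosed by `{x}` (empty moat) once `M ≥ 1`. [this file, g46] -/
theorem isEnclosed_of_le_eight {ϑc ωc ℓ : ℝ} {M : ℕ} (hℓ : ℓ ≤ 8) (hM : 1 ≤ M) {S H : Set E3} {x : E3} (hx : x ∈ S) :
    IsEnclosed ϑc ωc ℓ M S H x :=
  isEnclosed_of_coherent_collar hM hx (by rw [collar_eq_empty_of_le hℓ]; exact isCoherentOn_empty _ _ _ _)

/-- ★ THE CHAIN STEP (PROVED): if `x` escapes every container of `≤ M` sites, then EVERY admissible container `K ∋ x` has a NON-coherent star in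
its moat — iterating from `K₀ = {x}` (add the witness, which is `> 8` from `K` and `< ℓ` from it) an escaping star heads a `16`-linked, pairwise
`8`-separated chain of `≥ M` non-calm stars: the EXTENDED hot structure that [T_esc] is about. [this file, g46] -/
theorem exists_warm_moat_of_not_isEnclosed {ϑc ωc ℓ : ℝ} {M : ℕ} {S H : Set E3} {x : E3} (h : ¬ IsEnclosed ϑc ωc ℓ M S H x)
    {K : Set E3} (hKS : K ⊆ S) (hKf : K.Finite) (hxK : x ∈ K) (hKM : K.ncard ≤ M) :
    ∃ p ∈ moat S K ℓ, ¬ IsCoherentStar ϑc ωc S H p := by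
  by_contra hne
  exact h ⟨K, hKS, hKf, hxK, hKM, fun p hp => not_not.1 fun hp' => hne ⟨p, hp, hp'⟩⟩

/-! ### YF.2  The cut: [I_K] (local: calm moat ⇒ tame cluster), the window form [E_w], and the escaping residual [T_esc] -/

/-- ★★ **[I_K] «CalmMoatPG ϑ ϑc ωc ℓ M aHi Λ θ s» — A CALM MOAT FORCES A TAME CLUSTER** (the SPECIAL side, LOCAL form).  For every θ-good
`aHi`-GSC door set `S` (`IsDoorSetPG`: two-shell clean, single-site Nash, charted, e⋆-GSC), every equilibrium `s`-chart `(L, w)` at scale `a`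
(`IsEquilChart`) and every FINITE cluster `K ⊆ S` of `≤ M` sites: if the moat `moat S K ℓ` is `(ϑc, ωc)`-COHERENT to the chart lattice
`LayeredHom L w`, then every site of `K` has a `ϑ`-TAME star.  NO window, NO registration, NO flatness level, NO radius: the statement sees only the
sites within `ℓ` of `K` and the GSC/Nash axioms — a COMPACT hot cloud of `< M` cores is a finite, local object, whatever its shape.  CONTAINS
g45's [I] (`K = {x}`: `calmCollarPG_of_calmMoatPG`, PROVED); implies the window form [E_w] (`enclosedTameWindowPG_of_calmMoatPG`, PROVED);
INCOMPARABLE with [T]; trivial at `M = 0` (`calmMoatPG_zero`); STRENGTHENS with `M`, `ϑc`, `ωc` and with `ℓ` shrinking (`CalmMoatPG.mono`).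
MECHANISM-NAMED · GSC-priced · LOCAL · FINITE · UNDECIDED(stated tests: (F0e) «MoatScan» — on the defected-but-θ-good relaxed configurations of
(F0b) and the 54 windows of TAG 174 (a⁗), per site the Kabsch star misfit `m` and tilt `t` to the chart catalogue, the non-calm set
`N = {m > ϑc ∨ t > ωc}`, its `16`-linked clusters, and per `ϑ`-hot site `x` the size `M(x)` of the smallest container (`{x}` ∪ the clusters of `N`
meeting `ball x 16`, closed under `16`-linking); prediction: NO hot site with `M(x) ≤ 12` on configurations passing the finite e⋆-replacement
proxy; kill sign: an enclosed hot star passing the proxy — and (F0d′) «MoatGap», offline and certifiable: an interval lower bound `c_hot` for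
`E(filling) − E(chart filling)` over clean single-site-Nash fillings of containers of `≤ 12` cores with `(ϑc, ωc)`-calm moat and one `ϑ`-hot core,
against the feathering cost `C·(ϑc² + ωc²)·#moat` plus `r⁻⁶` tails) · ATTACKABLE·L (computer-assisted for `M ≲ 10²·c/C`): ONE e⋆-GSC exchange —
the sites within `(8+ℓ)/2` of `K` replaced by the chart patch fitted to the calm moat — gains `c_hot ≈ c·(ϑ/4)²·n(4)` from the hot core and pays
at most `C·(ϑc² + ωc²)·n(ℓ)` per core of the container, ratio `≈ (ϑ/ϑc)²·n(4)/n(ℓ)·c/C ≈ 10²·c/C` at the record literals; beyond that range [I_K] is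
the finite-volume GSC-SELECTION statement (the Cauchy–Born filling of a calm moat is the unique clean GSC filling), locally a theorem
(E–Ming, Ortner–Theil, Braun–Schmidt), globally open.
Why it might fail: (a) a second clean single-site-Nash filling of a container with calm moat, a hot core and energy within the feathering cost of
the chart filling (a near-degenerate localized mode, or for large `M` a buckled filling) — none known for Lennard-Jones close packings, none seen in
the census, no theorem excludes it; (b) the literals: `ϑc, ωc` must sit deep in the basin below `ϑ` (ratio `10²` here) and `M·n(ℓ)·ϑc²` below
`c_hot`; (c) `r⁻⁶` tails across a moat of width `ℓ − 8 ≥ 8`.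
Sources: E–Ming, Arch. Ration. Mech. Anal. 183 (2007) 241; Ortner–Theil, Arch. Ration. Mech. Anal. 207 (2013) 1025; Braun–Schmidt, arXiv
1604.00197, pp. 2–3; Ehrlacher–Ortner–Shapeev, Arch. Ration. Mech. Anal. 222 (2016) 1217 (far fields of localized anomalies, `r⁻³` decay);
Knops–Payne, Uniqueness Theorems in Linear Elasticity (1971) p. 5; Theil, Comm. Math. Phys. 262 (2006) 209; this tree: `IsEStarGSC`, [I] `CalmCollarPG`
(part UE), `IsCoherentOn` (part UD), `UniformTameStability` (part TP); census TAG 174 (a⁗), (F0)/(F0b) of NODE-g43. [this file, g46] -/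
def CalmMoatPG (ϑ ϑc ωc ℓ : ℝ) (M : ℕ) (aHi Λ θ s : ℝ) : Prop :=
  ∀ δ : ℝ, 0 < δ → ∀ a : ℝ, 0 < a →
    ∀ S : Set E3, IsDoorSetPG aHi δ S → (∀ q ∈ S, IsTwoShellAffineGood θ S q) →
      ∀ (L : E3 ≃L[ℝ] E3) (w : ℤ → E3), IsEquilChart a s Λ L w →
        ∀ K : Set E3, K ⊆ S → K.Finite → K.ncard ≤ M → IsCoherentOn ϑc ωc S (LayeredHom (L : E3 →L[ℝ] E3) w) (moat S K ℓ) →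
          IsTameOn ϑ S (LayeredHom (L : E3 →L[ℝ] E3) w) K

/-- ★ **[E_w] «EnclosedTameWindowPG ϑ ϑc ωc ℓ M aHi Λ θ s» — [T] AT THE ENCLOSED SITES** (the SPECIAL side, window form): verbatim [T]
`TameWindowPG ϑ` (part UC) with the conclusion restricted to the sites `x ∈ win 9R` that are `M`-enclosed relative to the chart lattice
(`IsEnclosed`).  WEAKER than [T] (`enclosedTameWindowPG_of_tameWindowPG`, PROVED); implied by the local statement [I_K]
(`enclosedTameWindowPG_of_calmMoatPG`, PROVED — the window data are not used); CONTAINS g45's [I_w] for `M ≥ 1`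
(`calmCollarWindowPG_of_enclosedTameWindowPG`, PROVED); with [T_esc] it gives [T] back EXACTLY (`tameWindowPG_iff_enclosedTameWindow_and_escaping`).
Bookkeeping form of the special side; unlike [I_K] it may also draw on the registration budget of the window, which bounds the moat's actual
deviation mass far below the worst case `ϑc²·#moat`.  Status and tests as [I_K].
Why it might fail: only if [I_K] fails AND the window data do not rescue it — scenario (a) of [I_K] realised inside a near-flat fat GSC window.
Sources: as [I_K]; part UC ([T]). [this file, g46] -/
def EnclosedTameWindowPG (ϑ ϑc ωc ℓ : ℝ) (M : ℕ) (aHi Λ θ s : ℝ) : Prop :=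
  ∀ δ : ℝ, 0 < δ → ∀ a : ℝ, 0 < a → ∀ Cg : ℝ, 1 ≤ Cg → ∀ K₀ : ℝ, 0 < K₀ → ∃ η₁ : ℝ, 0 < η₁ ∧ ∃ R₁ : ℝ, 0 < R₁ ∧
    ∀ S : Set E3, IsDoorSetPG aHi δ S → (∀ q ∈ S, IsTwoShellAffineGood θ S q) →
      ∀ η : ℝ, 0 < η → η ≤ η₁ → ∀ R : ℝ, R₁ ≤ R →
        ∀ (L : E3 ≃L[ℝ] E3) (w : ℤ → E3), IsEquilChart a s Λ L w →
          ∀ Ψ : E3 → E3, IsGlobalReg Cg η R S (LayeredHom (L : E3 →L[ℝ] E3) w) Ψ →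
            K₀ ≤ η * nK (atomsIn (μS S) 0 R) →
              ∀ x ∈ atomsIn (μS S) 0 (9 * R), IsEnclosed ϑc ωc ℓ M S (LayeredHom (L : E3 →L[ℝ] E3) w) x →
                IsTameStar ϑ S (LayeredHom (L : E3 →L[ℝ] E3) w) x

/-- ★★ **[T_esc] «EscapingTameWindowPG ϑ ϑc ωc ℓ M aHi Λ θ s» — NEAR-FLAT FAT GSC DOOR WINDOWS HAVE NO ESCAPING `ϑ`-HOT STAR** (the GENERIC side
= the residual): verbatim [T] `TameWindowPG ϑ` with the conclusion restricted to the sites `x ∈ win 9R` that are NOT `M`-enclosed — every finite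
container `K ∋ x` of `≤ M` sites has a warm (misfit `> ϑc`), hot, or wound (tilt `> ωc`) star in its moat; by the chain step
(`exists_warm_moat_of_not_isEnclosed`) such an `x` heads a `16`-linked, `8`-separated chain of `≥ M` non-calm stars.  A hot star carried by an
EXTENDED hot structure must still not occur.  WEAKER than [T] (`escapingTameWindowPG_of_tameWindowPG`, PROVED) and than g45's residual [T_cl]
(`escapingTameWindowPG_of_cloudTameWindowPG`, `1 ≤ M`, PROVED; strictly at currency level: a hot star with one warm companion at distance `12` in a
calm environment violates [T_cl], is `2`-enclosed, and is not addressed here); WEAKENS as `M`, `ϑc`, `ωc` grow or `ℓ` shrinks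
(`EscapingTameWindowPG.anti`); equal to [T] at `M = 0` (`tameWindowPG_of_escapingTameWindowPG_zero`) and vacuous for `ℓ ≤ 8 ∧ 1 ≤ M`
(`escapingTameWindowPG_of_le_eight`).  NEW · GSC-priced · UNDECIDED(stated test: (F0e) «MoatScan», quadrant `{m(x) ≥ ϑ, M(x) > 12}` on near-flat
windows; kill sign: a near-flat fat window passing the e⋆-replacement proxy with a hot star on a non-calm chain of `> 12` cores) · INSTRUMENTABLE ·
IDEA-NEEDED (an exchange organised ALONG the chain — tube competitor around the `16`-linked cluster, whose complement is calm by maximality — has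
lineal gain and lineal cost with no margin at the calm threshold; candidates: (i) raise the calm dial `ϑc ↑ ϑ/10` so that only chains of distinctly
warm cores remain, (ii) far-field decay `r⁻³` of self-equilibrated anomalies (Ehrlacher–Ortner–Shapeev) to show a chain cannot keep its own moats
warm without a lineal source, which perfect bond topology forbids).
Why it might fail: as [T] — a coherent, defect-free, self-equilibrated anomaly CHAIN or SHEET (single-site Nash, two-shell clean, charted) that no
finite grand-canonical replacement at `μ = e⋆` improves; none known for Lennard-Jones fcc/hcp, none seen in the census, no theorem excludes it.
Sources: as [T] (part UC) and [T_cl] (part UE): Ehrlacher–Ortner–Shapeev, Arch. Ration. Mech. Anal. 222 (2016) 1217; Theil, Comm. Math. Phys. 262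
(2006) 209; Flatley–Theil, arXiv 1407.0692; E–Ming, Arch. Ration. Mech. Anal. 183 (2007) 241; this tree: [T] `TameWindowPG`, [T_cl]
`CloudTameWindowPG`, `UniformTameStability` (part TP); census TAG 174 (a⁗), (F0b). [this file, g46] -/
def EscapingTameWindowPG (ϑ ϑc ωc ℓ : ℝ) (M : ℕ) (aHi Λ θ s : ℝ) : Prop :=
  ∀ δ : ℝ, 0 < δ → ∀ a : ℝ, 0 < a → ∀ Cg : ℝ, 1 ≤ Cg → ∀ K₀ : ℝ, 0 < K₀ → ∃ η₁ : ℝ, 0 < η₁ ∧ ∃ R₁ : ℝ, 0 < R₁ ∧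
    ∀ S : Set E3, IsDoorSetPG aHi δ S → (∀ q ∈ S, IsTwoShellAffineGood θ S q) →
      ∀ η : ℝ, 0 < η → η ≤ η₁ → ∀ R : ℝ, R₁ ≤ R →
        ∀ (L : E3 ≃L[ℝ] E3) (w : ℤ → E3), IsEquilChart a s Λ L w →
          ∀ Ψ : E3 → E3, IsGlobalReg Cg η R S (LayeredHom (L : E3 →L[ℝ] E3) w) Ψ →
            K₀ ≤ η * nK (atomsIn (μS S) 0 R) →
              ∀ x ∈ atomsIn (μS S) 0 (9 * R), ¬ IsEnclosed ϑc ωc ℓ M S (LayeredHom (L : E3 →L[ℝ] E3) w) x →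
                IsTameStar ϑ S (LayeredHom (L : E3 →L[ℝ] E3) w) x

/-- **[I_K] ⇒ [I] (PROVED, `1 ≤ M`)** — g45's local statement is the single-site case `K = {x}` of [I_K] (`moat_singleton`). [this file, g46] -/
theorem calmCollarPG_of_calmMoatPG {ϑ ϑc ωc ℓ : ℝ} {M : ℕ} {aHi Λ θ s : ℝ} (hM : 1 ≤ M) (h : CalmMoatPG ϑ ϑc ωc ℓ M aHi Λ θ s) :
    CalmCollarPG ϑ ϑc ωc ℓ aHi Λ θ s :=
  fun δ hδ a ha S hS hgood L w hLw x hx hc =>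
    h δ hδ a ha S hS hgood L w hLw {x} (singleton_subset_iff.2 hx) (finite_singleton x) (by rw [ncard_singleton]; exact hM)
      (by rw [moat_singleton]; exact hc) x (mem_singleton x)

/-- **[I_K] ⇒ [E_w] (PROVED)** — the local statement gives the window form (the window data are not used; `win 9R ⊆ S`). [this file, g46] -/
theorem enclosedTameWindowPG_of_calmMoatPG {ϑ ϑc ωc ℓ : ℝ} {M : ℕ} {aHi Λ θ s : ℝ} (h : CalmMoatPG ϑ ϑc ωc ℓ M aHi Λ θ s) :
    EnclosedTameWindowPG ϑ ϑc ωc ℓ M aHi Λ θ s := by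
  intro δ hδ a ha Cg _ K₀ _
  refine ⟨1, one_pos, 1, one_pos, fun S hS hgood η _ _ R _ L w hLw Ψ _ _ x _ hx => ?_⟩
  obtain ⟨K, hKS, hKf, hxK, hKM, hc⟩ := hx
  exact h δ hδ a ha S hS hgood L w hLw K hKS hKf hKM hc x hxK

/-- **[T] ⇒ [E_w] (PROVED)** — the special side is WEAKER than [T] (the enclosure hypothesis unused). [this file, g46] -/
theorem enclosedTameWindowPG_of_tameWindowPG {ϑ ϑc ωc ℓ : ℝ} {M : ℕ} {aHi Λ θ s : ℝ} (h : TameWindowPG ϑ aHi Λ θ s) :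
    EnclosedTameWindowPG ϑ ϑc ωc ℓ M aHi Λ θ s := by
  intro δ hδ a ha Cg hCg K₀ hK₀
  obtain ⟨η₁, hη₁, R₁, hR₁, h1⟩ := h δ hδ a ha Cg hCg K₀ hK₀
  exact ⟨η₁, hη₁, R₁, hR₁, fun S hS hgood η hη hηle R hR L w hLw Ψ hΨ hfat x hx _ =>
    h1 S hS hgood η hη hηle R hR L w hLw Ψ hΨ hfat x hx⟩

/-- **[T] ⇒ [T_esc] (PROVED)** — the residual is WEAKER than [T] (the escape hypothesis unused). [this file, g46] -/
theorem escapingTameWindowPG_of_tameWindowPG {ϑ ϑc ωc ℓ : ℝ} {M : ℕ} {aHi Λ θ s : ℝ} (h : TameWindowPG ϑ aHi Λ θ s) :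
    EscapingTameWindowPG ϑ ϑc ωc ℓ M aHi Λ θ s := by
  intro δ hδ a ha Cg hCg K₀ hK₀
  obtain ⟨η₁, hη₁, R₁, hR₁, h1⟩ := h δ hδ a ha Cg hCg K₀ hK₀
  exact ⟨η₁, hη₁, R₁, hR₁, fun S hS hgood η hη hηle R hR L w hLw Ψ hΨ hfat x hx _ =>
    h1 S hS hgood η hη hηle R hR L w hLw Ψ hΨ hfat x hx⟩

/-- ★★ **[T_cl] ⇒ [T_esc] (PROVED, `1 ≤ M`)** — the new residual is WEAKER than g45's: an escaping star is in particular clouded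
(`not_coherent_collar_of_not_isEnclosed`). [this file, g46] -/
theorem escapingTameWindowPG_of_cloudTameWindowPG {ϑ ϑc ωc ℓ : ℝ} {M : ℕ} {aHi Λ θ s : ℝ} (hM : 1 ≤ M)
    (h : CloudTameWindowPG ϑ ϑc ωc ℓ aHi Λ θ s) : EscapingTameWindowPG ϑ ϑc ωc ℓ M aHi Λ θ s := by
  intro δ hδ a ha Cg hCg K₀ hK₀
  obtain ⟨η₁, hη₁, R₁, hR₁, h1⟩ := h δ hδ a ha Cg hCg K₀ hK₀
  exact ⟨η₁, hη₁, R₁, hR₁, fun S hS hgood η hη hηle R hR L w hLw Ψ hΨ hfat x hx hne =>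
    h1 S hS hgood η hη hηle R hR L w hLw Ψ hΨ hfat x hx (not_coherent_collar_of_not_isEnclosed hM (atomsIn_subset S (9 * R) hx) hne)⟩

/-- **[E_w] ⇒ [I_w] (PROVED, `1 ≤ M`)** — the new special side CONTAINS g45's (a calm collar encloses). [this file, g46] -/
theorem calmCollarWindowPG_of_enclosedTameWindowPG {ϑ ϑc ωc ℓ : ℝ} {M : ℕ} {aHi Λ θ s : ℝ} (hM : 1 ≤ M)
    (h : EnclosedTameWindowPG ϑ ϑc ωc ℓ M aHi Λ θ s) : CalmCollarWindowPG ϑ ϑc ωc ℓ aHi Λ θ s := by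
  intro δ hδ a ha Cg hCg K₀ hK₀
  obtain ⟨η₁, hη₁, R₁, hR₁, h1⟩ := h δ hδ a ha Cg hCg K₀ hK₀
  exact ⟨η₁, hη₁, R₁, hR₁, fun S hS hgood η hη hηle R hR L w hLw Ψ hΨ hfat x hx hc =>
    h1 S hS hgood η hη hηle R hR L w hLw Ψ hΨ hfat x hx (isEnclosed_of_coherent_collar hM (atomsIn_subset S (9 * R) hx) hc)⟩

/-- ★★★ **SEAM (PROVED): `[E_w] ∧ [T_esc] ⇒ [T]`** — the dichotomy is exhaustive: each site of `win 9R` is `M`-enclosed or it is not (`em`);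
thresholds `η₁ := min`, `R₁ := max`.  The literals `(ϑc, ωc, ℓ, M)` are SHARED by the two sides — nothing is matched across the seam. [this file, g46] -/
theorem tameWindowPG_of_enclosedTameWindow_of_escaping {ϑ ϑc ωc ℓ : ℝ} {M : ℕ} {aHi Λ θ s : ℝ}
    (hE : EnclosedTameWindowPG ϑ ϑc ωc ℓ M aHi Λ θ s) (hX : EscapingTameWindowPG ϑ ϑc ωc ℓ M aHi Λ θ s) : TameWindowPG ϑ aHi Λ θ s := by
  intro δ hδ a ha Cg hCg K₀ hK₀
  obtain ⟨η₁, hη₁, R₁, hR₁, h1⟩ := hE δ hδ a ha Cg hCg K₀ hK₀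
  obtain ⟨η₁', hη₁', R₁', hR₁', h2⟩ := hX δ hδ a ha Cg hCg K₀ hK₀
  refine ⟨min η₁ η₁', lt_min hη₁ hη₁', max R₁ R₁', lt_max_of_lt_left hR₁, ?_⟩
  intro S hS hgood η hη hηle R hR L w hLw Ψ hΨ hfat x hx
  by_cases he : IsEnclosed ϑc ωc ℓ M S (LayeredHom (L : E3 →L[ℝ] E3) w) x
  · exact h1 S hS hgood η hη (hηle.trans (min_le_left _ _)) R ((le_max_left _ _).trans hR) L w hLw Ψ hΨ hfat x hx he
  · exact h2 S hS hgood η hη (hηle.trans (min_le_right _ _)) R ((le_max_right _ _).trans hR) L w hLw Ψ hΨ hfat x hx he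

/-- ★★★ **THE PARTITION (PROVED): `[T] ⟺ [E_w] ∧ [T_esc]`** at every value of the literals `(ϑc, ωc, ℓ, M)` — the one `iff` of this file;
g45's partition `[T] ⟺ [I_w] ∧ [T_cl]` is refined by it (`[E_w] ⇒ [I_w]`, `[T_cl] ⇒ [T_esc]`). [this file, g46] -/
theorem tameWindowPG_iff_enclosedTameWindow_and_escaping (ϑ ϑc ωc ℓ : ℝ) (M : ℕ) (aHi Λ θ s : ℝ) :
    TameWindowPG ϑ aHi Λ θ s ↔ EnclosedTameWindowPG ϑ ϑc ωc ℓ M aHi Λ θ s ∧ EscapingTameWindowPG ϑ ϑc ωc ℓ M aHi Λ θ s :=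
  ⟨fun h => ⟨enclosedTameWindowPG_of_tameWindowPG h, escapingTameWindowPG_of_tameWindowPG h⟩,
    fun h => tameWindowPG_of_enclosedTameWindow_of_escaping h.1 h.2⟩

/-- ★★★ **SEAM (PROVED): `[I_K] ∧ [T_esc] ⇒ [T]`** — the local statement and the escaping residual give the hot-star exclusion. [this file, g46] -/
theorem tameWindowPG_of_calmMoat_of_escaping {ϑ ϑc ωc ℓ : ℝ} {M : ℕ} {aHi Λ θ s : ℝ} (hI : CalmMoatPG ϑ ϑc ωc ℓ M aHi Λ θ s)
    (hX : EscapingTameWindowPG ϑ ϑc ωc ℓ M aHi Λ θ s) : TameWindowPG ϑ aHi Λ θ s :=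
  tameWindowPG_of_enclosedTameWindow_of_escaping (enclosedTameWindowPG_of_calmMoatPG hI) hX

/-- ★★ **THE g45 RESIDUAL IS CUT (PROVED): `[E_w] ∧ [T_esc] ⇒ [T_cl]`** (and `[T_cl] ⇒ [T_esc]` above): the clouded hot stars split into the
enclosed ones (special, local) and the escaping ones (generic). [this file, g46] -/
theorem cloudTameWindowPG_of_enclosedTameWindow_of_escaping {ϑ ϑc ωc ℓ : ℝ} {M : ℕ} {aHi Λ θ s : ℝ}
    (hE : EnclosedTameWindowPG ϑ ϑc ωc ℓ M aHi Λ θ s) (hX : EscapingTameWindowPG ϑ ϑc ωc ℓ M aHi Λ θ s) :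
    CloudTameWindowPG ϑ ϑc ωc ℓ aHi Λ θ s :=
  cloudTameWindowPG_of_tameWindowPG (tameWindowPG_of_enclosedTameWindow_of_escaping hE hX)

/-! ### YF.3  The two dials and the degenerate ends -/

/-- TRADE-OFF, special side: [I_K] is monotone in `ϑ`, gets STRONGER with the container size `M` and the calm levels `ϑc, ωc`, and WEAKER with
the moat radius `ℓ` (a larger moat is a stronger hypothesis). [this file, g46] -/
theorem CalmMoatPG.mono {ϑ ϑ' ϑc ϑc' ωc ωc' ℓ ℓ' : ℝ} {M M' : ℕ} {aHi Λ θ s : ℝ} (hϑ : ϑ ≤ ϑ') (hϑc : ϑc' ≤ ϑc) (hωc : ωc' ≤ ωc)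
    (hℓ : ℓ ≤ ℓ') (hM : M' ≤ M) (h : CalmMoatPG ϑ ϑc ωc ℓ M aHi Λ θ s) : CalmMoatPG ϑ' ϑc' ωc' ℓ' M' aHi Λ θ s :=
  fun δ hδ a ha S hS hgood L w hLw K hKS hKf hKM hc =>
    (h δ hδ a ha S hS hgood L w hLw K hKS hKf (hKM.trans hM) (hc.mono hϑc hωc (moat_mono S K hℓ))).mono hϑ subset_rfl

/-- TRADE-OFF, generic side: [T_esc] is monotone in `ϑ` and gets WEAKER with `M`, `ϑc`, `ωc` and with `ℓ` shrinking — exactly opposite to [I_K]: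
moving a dial shifts content between the two sides, never out of the pair (`tameWindowPG_iff_enclosedTameWindow_and_escaping`). [this file, g46] -/
theorem EscapingTameWindowPG.anti {ϑ ϑ' ϑc ϑc' ωc ωc' ℓ ℓ' : ℝ} {M M' : ℕ} {aHi Λ θ s : ℝ} (hϑ : ϑ ≤ ϑ') (hϑc : ϑc ≤ ϑc')
    (hωc : ωc ≤ ωc') (hℓ : ℓ' ≤ ℓ) (hM : M ≤ M') (h : EscapingTameWindowPG ϑ ϑc ωc ℓ M aHi Λ θ s) :
    EscapingTameWindowPG ϑ' ϑc' ωc' ℓ' M' aHi Λ θ s := by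
  intro δ hδ a ha Cg hCg K₀ hK₀
  obtain ⟨η₁, hη₁, R₁, hR₁, h1⟩ := h δ hδ a ha Cg hCg K₀ hK₀
  exact ⟨η₁, hη₁, R₁, hR₁, fun S hS hgood η hη hηle R hR L w hLw Ψ hΨ hfat x hx hne =>
    (h1 S hS hgood η hη hηle R hR L w hLw Ψ hΨ hfat x hx fun he => hne (he.mono hϑc hωc hℓ hM)).mono hϑ⟩

/-- DEGENERATE END `M = 0` (vacuity guard): [I_K] holds trivially — no nonempty container has `≤ 0` sites. [this file, g46] -/
theorem calmMoatPG_zero (ϑ ϑc ωc ℓ aHi Λ θ s : ℝ) : CalmMoatPG ϑ ϑc ωc ℓ 0 aHi Λ θ s := by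
  intro δ _ a _ S _ _ L w _ K _ hKf hK0 _ x hx
  have h := (Set.ncard_pos hKf).2 ⟨x, hx⟩
  omega

/-- DEGENERATE END `M = 0`: [T_esc] at `M = 0` is [T] itself — all content sits in the residual. [this file, g46] -/
theorem tameWindowPG_of_escapingTameWindowPG_zero {ϑ ϑc ωc ℓ aHi Λ θ s : ℝ} (h : EscapingTameWindowPG ϑ ϑc ωc ℓ 0 aHi Λ θ s) :
    TameWindowPG ϑ aHi Λ θ s := by
  intro δ hδ a ha Cg hCg K₀ hK₀
  obtain ⟨η₁, hη₁, R₁, hR₁, h1⟩ := h δ hδ a ha Cg hCg K₀ hK₀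
  exact ⟨η₁, hη₁, R₁, hR₁, fun S hS hgood η hη hηle R hR L w hLw Ψ hΨ hfat x hx =>
    h1 S hS hgood η hη hηle R hR L w hLw Ψ hΨ hfat x hx not_isEnclosed_zero⟩

/-- DEGENERATE END `ℓ ≤ 8` (vacuity guard): every site is enclosed by `{x}` and [T_esc] holds vacuously once `M ≥ 1` — all of [T] then sits in
[E_w].  The record literals `ℓ = 16`, `M = 12` keep both sides populated. [this file, g46] -/
theorem escapingTameWindowPG_of_le_eight {ϑ ϑc ωc ℓ : ℝ} {M : ℕ} {aHi Λ θ s : ℝ} (hℓ : ℓ ≤ 8) (hM : 1 ≤ M) :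
    EscapingTameWindowPG ϑ ϑc ωc ℓ M aHi Λ θ s := by
  intro δ _ a _ Cg _ K₀ _
  exact ⟨1, one_pos, 1, one_pos, fun S _ _ η _ _ R _ L w _ Ψ _ _ x hx hne =>
    absurd (isEnclosed_of_le_eight hℓ hM (atomsIn_subset S (9 * R) hx)) hne⟩

/-! ### YF.4  The line down to [C] and (M), and the record literals -/

/-- the CONTAINER SIZE of record: `12` cores (inside the range `M ≲ 10²·c/C` where one e⋆-GSC exchange has force); pending calibration by
(F0e)/(F0d′). [this file, g46] -/
def clusterSize : ℕ := 12

/-- the record container size admits the single-site container. [this file, g46] -/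
theorem one_le_clusterSize : 1 ≤ clusterSize := by norm_num [clusterSize]

/-- ★★★ **COROLLARY (PROVED): the calm-moat line down to [C]** — `[I_K] ∧ [T_esc] ∧ [KS] ∧ [W] ∧ [CC°_W] ⇒ [C] RigidCaccioppoliPG`. [this file, g46] -/
theorem rigidCaccioppoliPG_of_calmMoat_line {ϑ ϑc ωc ℓ : ℝ} {M : ℕ} {aHi Λ θ s : ℝ} (hI : CalmMoatPG ϑ ϑc ωc ℓ M aHi Λ θ s)
    (hX : EscapingTameWindowPG ϑ ϑc ωc ℓ M aHi Λ θ s) (hKS : KornSobolevPoincareP aHi θ) (hW : CoherentWindowPG ϑ aHi Λ θ s)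
    (hC : CoherentGscCaccioppoliPG ϑ aHi Λ θ s) : RigidCaccioppoliPG aHi Λ θ s :=
  rigidCaccioppoliPG_of_coherent_line (tameWindowPG_of_calmMoat_of_escaping hI hX) hKS hW hC

/-- ★★★ **COROLLARY (PROVED): the calm-moat line down to (M)** — with the Gehring leaf (part UB): `[I_K] ∧ [T_esc] ∧ [KS] ∧ [W] ∧ [CC°_W] ∧ leaf
⇒ StrainNonConcentrationPG` (`aHi ≤ 8/7`). [this file, g46] -/
theorem strainNonConcentrationPG_of_calmMoat_line {ϑ ϑc ωc ℓ : ℝ} {M : ℕ} {aHi Λ θ s : ℝ} (haHi : aHi ≤ 8 / 7)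
    (hG : ZatorskaGoldstein2005_localGehringLemmaCounting) (hI : CalmMoatPG ϑ ϑc ωc ℓ M aHi Λ θ s)
    (hX : EscapingTameWindowPG ϑ ϑc ωc ℓ M aHi Λ θ s) (hKS : KornSobolevPoincareP aHi θ) (hW : CoherentWindowPG ϑ aHi Λ θ s)
    (hC : CoherentGscCaccioppoliPG ϑ aHi Λ θ s) : StrainNonConcentrationPG aHi Λ θ s :=
  strainNonConcentrationPG_of_coherent_line haHi hG (tameWindowPG_of_calmMoat_of_escaping hI hX) hKS hW hC

/-- Record example at the literals `(aHi; Λ, θ, s; ϑ; ϑc, ωc, ℓ; M) = (1; 2, 1/16, 1/50; tameRadius; calmLevel, calmLevel, collarRadius;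
clusterSize)`: the pair [I_K] ∧ [T_esc] replaces [I] ∧ [T_cl] (hence [T]) in the line of record down to [C]. -/
example (hI : CalmMoatPG tameRadius calmLevel calmLevel collarRadius clusterSize 1 2 (1 / 16) (1 / 50))
    (hX : EscapingTameWindowPG tameRadius calmLevel calmLevel collarRadius clusterSize 1 2 (1 / 16) (1 / 50))
    (hKS : KornSobolevPoincareP 1 (1 / 16)) (hW : CoherentWindowPG tameRadius 1 2 (1 / 16) (1 / 50))
    (hC : CoherentGscCaccioppoliPG tameRadius 1 2 (1 / 16) (1 / 50)) : RigidCaccioppoliPG 1 2 (1 / 16) (1 / 50) :=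
  rigidCaccioppoliPG_of_calmMoat_line hI hX hKS hW hC

/-- Record example at the same literals: the g46 local statement gives the g45 one, and the g45 residual gives the g46 one. -/
example (hI : CalmMoatPG tameRadius calmLevel calmLevel collarRadius clusterSize 1 2 (1 / 16) (1 / 50))
    (hCl : CloudTameWindowPG tameRadius calmLevel calmLevel collarRadius 1 2 (1 / 16) (1 / 50)) :
    CalmCollarPG tameRadius calmLevel calmLevel collarRadius 1 2 (1 / 16) (1 / 50) ∧
      EscapingTameWindowPG tameRadius calmLevel calmLevel collarRadius clusterSize 1 2 (1 / 16) (1 / 50) :=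
  ⟨calmCollarPG_of_calmMoatPG one_le_clusterSize hI, escapingTameWindowPG_of_cloudTameWindowPG one_le_clusterSize hCl⟩

end Summit.AtomisticToContinuum.Crystallization.Theorems.ChartedZeroExcessLayeredLatticeLiouville

end
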